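import Summits.CriticalPhenomena.PercolationContinuityZ3.Theorems.PercNearOneGluingNoHeavyQuantFarSunLargeK
import HarnessLib

/-!
# FAR beyond trees: `Quant.FarRelayRow`'s body at EVERY layer `j ≥ 2` on every hairy cycle with `K` pendant relays, `(64·2^j+2)² ≤ j·K`

builds on p205010 (kernel theorem, internal audit signed; external expert review pending)

Support file (`--supports stmt-CriticalPhenomena-4575`), seat `prim-cert-1` (gen 41); memo `prim-cert-1/FROM-prim-cert-1-g41-ALL-LAYERS.md` §0(iv).
The measure-level (graph) form of `HairyCycle.sunFAR_of_largeK` (…QuantFarSunLargeK), through the bridge `HairyCycle.farRelayRow_hairyCycle_of_sunFAR`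
(…QuantFarSunRow): on EVERY hairy cycle `IsHairyCycle L cyc K base tip` (cycle of any length `L`, `K` pendant relays, all weights supported on the cycle and
hair pairs), for every layer `j ≥ 2` with `(64·2^j+2)² ≤ j·K`:  `2j < Σ_a P(o ↔ a)` and `P(o ↮ a) ≤ t` (`a` a relay) imply `P(#{a : o ↔ a} ≤ j) ≤ t`.
* **`HairyCycle.farRelayRow_hairyCycle_of_largeK`**.  No definitions, no sorries, standard axioms.  [this work]
[cite: KozmaNitzan2024, Lemma 2 (p. 6), Conjecture 3 (p. 15)] (context: the lower-tail family FAR serves).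
-/

noncomputable section

namespace Summit.CriticalPhenomena.PercolationContinuityZ3.Theorems.HairyCycle

open Finset MeasureTheory
open Literature.Probability.Percolation Literature.Probability.LatticeModels
open Summit.CriticalPhenomena.PercolationContinuityZ3.Theorems.TwoCopy
open scoped Classical

/-- **FAR (`Quant.FarRelayRow`'s body) at every layer `j ≥ 2` on every hairy cycle with `K` pendant relays, `(64·2^j+2)² ≤ j·K`**, all weights. [this work] -/
theorem farRelayRow_hairyCycle_of_largeK {n L K : ℕ} {cyc : ℕ → Fin n} {base : ℕ → ℕ} {tip : ℕ → Fin n} (H : IsHairyCycle L cyc K base tip)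
    {j : ℕ} (hj : 2 ≤ j) (hK : (64 * 2 ^ j + 2) ^ 2 ≤ j * K) (w : Sym2 (Fin n) → unitInterval)
    (hsupp : ∀ e : Sym2 (Fin n), ¬ e.IsDiag → w e ≠ 0 →
      (∃ i, i < L ∧ e = cycE L cyc i) ∨ (∃ k, k < K ∧ e = hairE cyc base tip k))
    (t : ℝ)
    (hEN : (2 * j : ℝ) < ∑ a ∈ (Finset.range K).image tip, (prodBernoulli w).real (openConn (cyc 0) a))
    (hcut : ∀ a ∈ (Finset.range K).image tip, (prodBernoulli w).real (openConn (cyc 0) a)ᶜ ≤ t) :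
    (prodBernoulli w).real {ω : BondConfig (Fin n) |
      (((Finset.range K).image tip).filter fun a => ω ∈ openConn (cyc 0) a).card ≤ j} ≤ t :=
  farRelayRow_hairyCycle_of_sunFAR H (sunFAR_of_largeK hj hK) w hsupp t hEN hcut

end Summit.CriticalPhenomena.PercolationContinuityZ3.Theorems.HairyCycle

end
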